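import Literature.NumberTheory.LFunctions.Zhang2022.Section8Lemma82
import Literature.NumberTheory.LFunctions.Zhang2022.RepairGapLemma58Premise
import HarnessLib

/-!
# Zhang (2022), rescue GAP/BED (D-0124 (3)(4)): Lemma 8.2 — the first consumer of the Lemma 5.8 door —
# holds under the MINIMUM PREMISE `‖L(1,χ)‖ ≤ 𝓛⁻¹⁵` (the (A)-exponent `E ≥ 15` one node further down
# the §8 chain toward (8.23)/(9.7)/(10.17))

Topic `Literature/NumberTheory/LFunctions/Zhang2022` (Landau–Siegel audit tree; verdict-neutral).
Y. Zhang, *Discrete mean estimates and the Landau–Siegel zero*, arXiv:2211.02515v1 (2022)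
[Zhang2022LandauSiegel] — **an unrefereed manuscript under adjudication; nothing in this file asserts or
denies its Theorems 1–2, and nothing here is a claim about Landau–Siegel zeros. The programme SEARCHES and
TYPES; no claim about Landau–Siegel zeros, Theorems 1–2 of arXiv:2211.02515 or a repaired Margin232 until a
kernel theorem says so.**

Lemma 8.2 (§8 p. 45; its consumed `ϰ_i`-form after Lemma 8.4) is the mean-value input of the main terms of the
nodes (8.23)/(9.7)/(10.17). The tree proves it (`Section8Lemma82.lean`: `Lemma82.norm_residue_sub_main_le` →
`sum_twist_log_sub_main_le` → `lemma_8_2_general` → `lemma_8_2`, `lemma_8_2_varkappa(_printed)`) under the printed (A)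
`‖L(1,χ)‖ ≤ 𝓛⁻²⁰²²`, which enters at ONE place only: the call to `Lemma58.lemma_5_8_of_le` in the residue step (l.701).
The Lemma 5.8 passage consumes (A) at strength exactly `𝓛⁻¹⁵` (`Repair.Gap.lemma58_of_norm_le_pow15`), so Lemma 8.2
holds under the MINIMUM PREMISE `‖L(1,χ)‖ ≤ 𝓛⁻¹⁵` with the SAME constants. The six theorems below are the tree's proofs
VERBATIM (every cited lemma is the tree's, namespace `Lemma82`) with that hypothesis swap and the one call replaced:
`norm_residue_sub_main_le_pow15`, `sum_twist_log_sub_main_le_pow15` (constant `Lemma82.C82 K`),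
`lemma82_general_of_norm_le_pow15`, `lemma82_of_norm_le_pow15` (as printed), `lemma82_varkappa_of_norm_le_pow15`,
`lemma82_varkappa_printed_of_norm_le_pow15`. So GAP G-31's «main terms only: E ≥ 15» is kernel at the Lemma 5.8 door AND
at its first consumer; the later §8–§10 nodes stay typed under `Skeleton.AssumptionA` (E = 2022) and are not re-typed
here. Theorems only; no definition, no named fact; nothing about (A) itself.

## References

* Y. Zhang, arXiv:2211.02515v1 (2022), §8 Lemma 8.2 and the display after Lemma 8.4; §5 Lemma 5.8; (2.13), (2.22).
  [cite: Zhang2022LandauSiegel, §8, Lemma 8.2]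
-/

noncomputable section

open Complex Filter Topology Set Real MeasureTheory

namespace Literature.NumberTheory.LFunctions.Zhang2022.Repair.Gap

open Literature.NumberTheory.LFunctions.Zhang2022.Lemma82
open Literature.NumberTheory.LFunctions.Zhang2022.Lemma58 (norm_taylor_two_remainder_le)

/-- **The residue against the main term**: for `χ` primitive mod `D`, `log D ≥ 3`, `‖L(1,χ)‖ ≤ 𝓛^{-15}` (in place of (A)),
`4Kπ ≤ 𝓛⁸`, `‖δ‖ ≤ Kα` (`α = π𝓛^{-9}`) and `1 ≤ x ≤ P = e^{𝓛⁹}`: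
`‖(log x)L(1+δ,χ) + L′(1+δ,χ) − L′(1,χ)(1 + δ log x)‖ ≤ (C_K + 64e^{9/2}(K+1)π) 𝓛^{-6}`,
`C_K = 1 + 16e^{9/2}π²K²` — Lemma 5.8 for `L(1+δ,χ) = L′(1,χ)δ + O(𝓛^{-15})` (times
`log x ≤ 𝓛⁹`) and a Cauchy estimate for `L′(1+δ,χ) − L′(1,χ) = O(α𝓛³)`; this is the source's
"`= L′(1,χ)·(2πi)^{-1}∮ x^s(s−β_j)(s−β_μ)^{-2}ds + O(𝓛^{-6})`" followed by "direct calculation".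
[cite: Zhang2022LandauSiegel, §8, proof of Lemma 8.2; §5, Lemma 5.8] -/
theorem norm_residue_sub_main_le_pow15 {D : ℕ} [NeZero D] (χ : DirichletCharacter ℂ D)
    (hprim : χ.IsPrimitive) (hL : 3 ≤ Real.log D) (h15 : ‖χ.LFunction 1‖ ≤ 1 / Real.log D ^ 15)
    {K : ℝ} (hK0 : 0 ≤ K) (hK : 4 * K * π ≤ Real.log D ^ 8) {δ : ℂ}
    (hδ : ‖δ‖ ≤ K * π / Real.log D ^ 9) {x : ℝ} (hx1 : 1 ≤ x)
    (hxP : x ≤ Real.exp (Real.log D ^ 9)) :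
    ‖(Real.log x : ℂ) * χ.LFunction (1 + δ) + deriv χ.LFunction (1 + δ) -
        deriv χ.LFunction 1 * (1 + δ * Real.log x)‖ ≤
      ((1 + 16 * Real.exp (9 / 2) * π ^ 2 * K ^ 2) + 64 * Real.exp (9 / 2) * (K + 1) * π) /
        Real.log D ^ 6 := by
  have hD2 : 2 ≤ D := by
    rcases Nat.lt_or_ge D 2 with h | h
    · interval_cases D <;> norm_num at hL
    · exact h
  set Lg : ℝ := Real.log D with hLdef
  have hL0 : 0 < Lg := by linarith
  have hL1 : 1 ≤ Lg := by linarith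
  have hπ := Real.pi_pos
  have hχ1 : χ ≠ 1 := Lemma31.ne_one_of_isPrimitive χ hD2 hprim
  have hx0 : 0 < x := by linarith
  have hlogx0 : 0 ≤ Real.log x := Real.log_nonneg hx1
  have hlogxP : Real.log x ≤ Lg ^ 9 := by
    have := Real.log_le_log hx0 hxP
    rwa [Real.log_exp] at this
  -- (i) Lemma 5.8 at `s = 1 + δ`
  have hKL : K * π ≤ Lg ^ 8 := by nlinarith
  have hE1 := lemma58_of_norm_le_pow15 χ hprim hL h15 (K := K) hKL (s := 1 + δ) (by simpa using hδ)
  rw [show (1 : ℂ) + δ - 1 = δ by ring] at hE1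
  -- (ii) Cauchy estimate for `L′(1+δ) − L′(1)`
  set r : ℝ := (K + 1) * π / Lg ^ 9 with hrdef
  have hr0 : 0 < r := by positivity
  have hδr : ‖δ‖ ≤ r := by
    refine hδ.trans ?_
    rw [hrdef]; gcongr; linarith
  have h2r : 2 * r ≤ 1 / Lg := by
    have h8 : (3 : ℝ) ^ 8 ≤ Lg ^ 8 := pow_le_pow_left₀ (by norm_num) hL 8
    have h2K : 2 * (K + 1) * π ≤ Lg ^ 8 := by nlinarith [Real.pi_le_four]
    rw [hrdef, show 2 * ((K + 1) * π / Lg ^ 9) = (2 * (K + 1) * π) / Lg ^ 9 by ring,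
      div_le_div_iff₀ (pow_pos hL0 9) hL0]
    calc 2 * (K + 1) * π * Lg ≤ Lg ^ 8 * Lg := mul_le_mul_of_nonneg_right h2K hL0.le
      _ = 1 * Lg ^ 9 := by ring
  set Gf : ℂ → ℂ := fun z => χ.LFunction z - χ.LFunction 1 - deriv χ.LFunction 1 * (z - 1)
    with hGfdef
  have hLd := DirichletCharacter.differentiable_LFunction hχ1
  have hGf_diff : Differentiable ℂ Gf := by
    rw [hGfdef]; fun_prop
  have hGf_deriv : deriv Gf (1 + δ) = deriv χ.LFunction (1 + δ) - deriv χ.LFunction 1 := by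
    have h1 : HasDerivAt χ.LFunction (deriv χ.LFunction (1 + δ)) (1 + δ) := (hLd _).hasDerivAt
    have h2 : HasDerivAt (fun z : ℂ => deriv χ.LFunction 1 * (z - 1)) (deriv χ.LFunction 1 * 1)
        (1 + δ) := ((hasDerivAt_id _).sub_const 1).const_mul _
    have h := (h1.sub_const (χ.LFunction 1)).sub h2
    rw [mul_one] at h
    exact h.deriv
  set M : ℝ := 8 * Real.exp (9 / 2) * (1 + Lg) * Lg ^ 2 * (2 * r) ^ 2 with hMdef
  have hsphere : ∀ z ∈ Metric.sphere (1 + δ) r, ‖Gf z‖ ≤ M := by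
    intro z hz
    rw [Metric.mem_sphere, dist_eq_norm] at hz
    have hz1 : ‖z - 1‖ ≤ 2 * r := by
      calc ‖z - 1‖ = ‖(z - (1 + δ)) + δ‖ := by ring_nf
        _ ≤ ‖z - (1 + δ)‖ + ‖δ‖ := norm_add_le _ _
        _ ≤ 2 * r := by rw [hz]; linarith
    have hz1' : ‖z - 1‖ ≤ 1 / Real.log D := hz1.trans h2r
    have h := norm_taylor_two_remainder_le χ hL hprim hz1'
    refine h.trans ?_
    rw [hMdef]
    have : ‖z - 1‖ ^ 2 ≤ (2 * r) ^ 2 := pow_le_pow_left₀ (norm_nonneg _) hz1 2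
    have h0 : 0 ≤ 8 * Real.exp (9 / 2) * (1 + Lg) * Lg ^ 2 := by positivity
    exact mul_le_mul_of_nonneg_left this h0
  have hE2 : ‖deriv χ.LFunction (1 + δ) - deriv χ.LFunction 1‖ ≤
      64 * Real.exp (9 / 2) * (K + 1) * π / Lg ^ 6 := by
    rw [← hGf_deriv]
    have h := Complex.norm_deriv_le_of_forall_mem_sphere_norm_le hr0 hGf_diff.diffContOnCl hsphere
    refine h.trans ?_
    have hMr : M / r = 32 * Real.exp (9 / 2) * (1 + Lg) * Lg ^ 2 * r := by
      rw [hMdef]; field_simp; ring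
    rw [hMr, hrdef]
    have h1L : 1 + Lg ≤ 2 * Lg := by linarith
    rw [show 32 * Real.exp (9 / 2) * (1 + Lg) * Lg ^ 2 * ((K + 1) * π / Lg ^ 9) =
      (32 * Real.exp (9 / 2) * (K + 1) * π) * ((1 + Lg) * Lg ^ 2 / Lg ^ 9) by ring,
      show 64 * Real.exp (9 / 2) * (K + 1) * π / Lg ^ 6 =
      (32 * Real.exp (9 / 2) * (K + 1) * π) * (2 / Lg ^ 6) by ring]
    refine mul_le_mul_of_nonneg_left ?_ (by positivity)
    rw [div_le_div_iff₀ (by positivity) (by positivity)]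
    calc (1 + Lg) * Lg ^ 2 * Lg ^ 6 ≤ (2 * Lg) * Lg ^ 2 * Lg ^ 6 := by gcongr
      _ = 2 * Lg ^ 9 := by ring
  -- (iii) assemble
  have hsplit : (Real.log x : ℂ) * χ.LFunction (1 + δ) + deriv χ.LFunction (1 + δ) -
      deriv χ.LFunction 1 * (1 + δ * Real.log x) =
      (Real.log x : ℂ) * (χ.LFunction (1 + δ) - deriv χ.LFunction 1 * δ) +
        (deriv χ.LFunction (1 + δ) - deriv χ.LFunction 1) := by ring
  rw [hsplit]
  have hnlog : ‖(Real.log x : ℂ)‖ = Real.log x := by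
    rw [Complex.norm_real, Real.norm_eq_abs, abs_of_nonneg hlogx0]
  calc ‖(Real.log x : ℂ) * (χ.LFunction (1 + δ) - deriv χ.LFunction 1 * δ) +
        (deriv χ.LFunction (1 + δ) - deriv χ.LFunction 1)‖
      ≤ ‖(Real.log x : ℂ) * (χ.LFunction (1 + δ) - deriv χ.LFunction 1 * δ)‖ +
        ‖deriv χ.LFunction (1 + δ) - deriv χ.LFunction 1‖ := norm_add_le _ _
    _ ≤ Lg ^ 9 * ((1 + 16 * Real.exp (9 / 2) * π ^ 2 * K ^ 2) / Lg ^ 15) +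
        64 * Real.exp (9 / 2) * (K + 1) * π / Lg ^ 6 := by
        rw [norm_mul, hnlog]
        exact add_le_add (mul_le_mul hlogxP hE1 (norm_nonneg _) (by positivity)) hE2
    _ = ((1 + 16 * Real.exp (9 / 2) * π ^ 2 * K ^ 2) + 64 * Real.exp (9 / 2) * (K + 1) * π) /
        Lg ^ 6 := by
        field_simp

/-- **The core estimate** (Lemma 8.2 with the factor `x^{β_μ}` removed): for `χ` primitive mod `D`,
`log D ≥ 3`, the MINIMUM PREMISE `‖L(1,χ)‖ ≤ 𝓛^{-15}` in place of (A), `4Kπ ≤ 𝓛⁸`, `δ` purely imaginary with `‖δ‖ ≤ Kα`,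
`α = π𝓛^{-9}`, and `T = exp(𝓛^{11/10}) ≤ x ≤ P = exp(𝓛⁹)`:
`‖∑_{m ≤ x} χ(m) m^{-1-δ} log(x/m) − L′(1,χ)(1 + δ log x)‖ ≤ C82(K) 𝓛^{-6}`.
[cite: Zhang2022LandauSiegel, §8, Lemma 8.2] -/
theorem sum_twist_log_sub_main_le_pow15 {D : ℕ} [NeZero D] (χ : DirichletCharacter ℂ D)
    (hprim : χ.IsPrimitive) (hL : 3 ≤ Real.log D) (h15 : ‖χ.LFunction 1‖ ≤ 1 / Real.log D ^ 15)
    {K : ℝ} (hK0 : 0 ≤ K) (hK : 4 * K * π ≤ Real.log D ^ 8) {δ : ℂ} (hδre : δ.re = 0)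
    (hδ : ‖δ‖ ≤ K * π / Real.log D ^ 9) {x : ℝ} (hxT : Real.exp (Real.log D ^ (11 / 10 : ℝ)) ≤ x)
    (hxP : x ≤ Real.exp (Real.log D ^ 9)) :
    ‖(∑ m ∈ Finset.Ioc 0 ⌊x⌋₊, twist χ δ m * (Real.log (x / m) : ℂ)) -
        deriv χ.LFunction 1 * (1 + δ * Real.log x)‖ ≤ C82 K / Real.log D ^ 6 := by
  have hD2 : 2 ≤ D := by
    rcases Nat.lt_or_ge D 2 with h | h
    · interval_cases D <;> norm_num at hL
    · exact h
  set Lg : ℝ := Real.log D with hLdef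
  have hL0 : 0 < Lg := by linarith
  have hπ := Real.pi_pos
  have hχ1 : χ ≠ 1 := Lemma31.ne_one_of_isPrimitive χ hD2 hprim
  -- `x ≥ T ≥ 1`
  have hx1 : 1 ≤ x := by
    refine le_trans ?_ hxT
    have : (0 : ℝ) ≤ Lg ^ (11 / 10 : ℝ) := by positivity
    calc (1 : ℝ) = Real.exp 0 := (Real.exp_zero).symm
      _ ≤ Real.exp (Lg ^ (11 / 10 : ℝ)) := Real.exp_le_exp.2 this
  have hx0 : 0 < x := by linarith
  -- `‖δ‖ ≤ 1`
  have hδ1 : ‖δ‖ ≤ 1 := by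
    refine hδ.trans ?_
    rw [div_le_one (by positivity)]
    have h9 : Lg ^ 8 ≤ Lg ^ 9 := by
      calc Lg ^ 8 = Lg ^ 8 * 1 := (mul_one _).symm
        _ ≤ Lg ^ 8 * Lg := by gcongr; linarith
        _ = Lg ^ 9 := by ring
    nlinarith
  set η : ℝ := 1 / Lg with hηdef
  have hη0 : 0 < η := by positivity
  have hη2 : η ≤ 1 / 2 := by rw [hηdef, div_le_div_iff₀ hL0 (by norm_num)]; linarith
  -- the line shift across the double pole at `0`
  have hstrip := Literature.Analysis.Complex.integral_vertical_sub_eq_sum_of_poles_dslope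
    (F := G χ δ x) (σ₁ := -η) (κ := 1) (by linarith) ({0} : Finset ℂ) (fun _ => 1)
    (fun _ => phi χ δ x) univ isOpen_univ (subset_univ _)
    (fun p hp => by
      rw [Finset.mem_singleton] at hp; subst hp
      simp only [Complex.zero_re]; exact ⟨by linarith, one_pos⟩)
    (by
      rw [Finset.coe_singleton]
      intro z hz
      have hz0 : z ≠ 0 := by simpa using hz
      exact (differentiableAt_G χ hχ1 δ hx0 hz0).differentiableWithinAt)
    (fun p hp => by
      rw [Finset.mem_singleton] at hp
      subst hp
      exact ⟨univ, univ_mem, (differentiable_phi χ hχ1 δ hx0).differentiableOn,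
        fun z _ _ => G_eq_phi_div χ δ x z⟩)
    (integrable_G_right χ hχ1 hδre hx0)
    (integrable_G_left χ hL hχ1 hδre hδ1 hx0)
    (G_horizontal_decay χ hχ1 hδre hδ1 hx1 hη2)
  rw [Finset.sum_singleton, residue_eq χ hχ1 δ hx0] at hstrip
  -- Perron
  have hperron := sum_eq_integral χ hδre hx0
  have e1 : (∫ t : ℝ, G χ δ x (((1 : ℝ) : ℂ) + t * I)) = ∫ t : ℝ, G χ δ x (1 + t * I) := by
    norm_num
  rw [e1] at hstrip
  set Ileft := ∫ t : ℝ, G χ δ x ((((-η : ℝ)) : ℂ) + t * I) with hIleft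
  set R := (Real.log x : ℂ) * χ.LFunction (1 + δ) + deriv χ.LFunction (1 + δ) with hR
  have hint : (∫ t : ℝ, G χ δ x (1 + t * I)) = Ileft + 2 * π * R := by
    rw [← hstrip]; ring
  have hπ0 : (π : ℂ) ≠ 0 := by exact_mod_cast hπ.ne'
  have hS : (∑ m ∈ Finset.Ioc 0 ⌊x⌋₊, twist χ δ m * (Real.log (x / m) : ℂ)) =
      (1 / (2 * π) : ℂ) * Ileft + R := by
    rw [hperron, hint, mul_add]
    congr 1
    field_simp
  rw [hS, show (1 / (2 * π) : ℂ) * Ileft + R - deriv χ.LFunction 1 * (1 + δ * Real.log x) =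
    (1 / (2 * π) : ℂ) * Ileft + (R - deriv χ.LFunction 1 * (1 + δ * Real.log x)) by ring]
  -- the two error terms
  have hres := norm_residue_sub_main_le_pow15 χ hprim hL h15 hK0 hK hδ hx1 hxP
  have hleft := norm_integral_G_left_le χ hL hχ1 hδre hδ1 hx0
  have hxfac := rpow_neg_inv_log_mul_le hL hxT
  have hnorm2π : ‖(1 / (2 * π) : ℂ)‖ = 1 / (2 * π) := by
    rw [norm_div, norm_one, norm_mul, Complex.norm_real, Real.norm_eq_abs, abs_of_pos hπ]
    norm_num
  have hI0 := I0_nonneg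
  calc ‖(1 / (2 * π) : ℂ) * Ileft + (R - deriv χ.LFunction 1 * (1 + δ * Real.log x))‖
      ≤ ‖(1 / (2 * π) : ℂ) * Ileft‖ + ‖R - deriv χ.LFunction 1 * (1 + δ * Real.log x)‖ :=
        norm_add_le _ _
    _ ≤ 1 / (2 * π) * (x ^ (-(1 / Lg)) * (4 / 9 * Real.exp 1 * Lg ^ 3) * I0) +
        ((1 + 16 * Real.exp (9 / 2) * π ^ 2 * K ^ 2) + 64 * Real.exp (9 / 2) * (K + 1) * π) /
          Lg ^ 6 := by
        rw [norm_mul, hnorm2π]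
        exact add_le_add (mul_le_mul_of_nonneg_left hleft (by positivity)) hres
    _ = 1 / (2 * π) * (4 / 9 * Real.exp 1 * I0) * (x ^ (-(1 / Lg)) * Lg ^ 3) +
        ((1 + 16 * Real.exp (9 / 2) * π ^ 2 * K ^ 2) + 64 * Real.exp (9 / 2) * (K + 1) * π) /
          Lg ^ 6 := by ring
    _ ≤ 1 / (2 * π) * (4 / 9 * Real.exp 1 * I0) * ((Nat.factorial 90 : ℝ) / Lg ^ 6) +
        ((1 + 16 * Real.exp (9 / 2) * π ^ 2 * K ^ 2) + 64 * Real.exp (9 / 2) * (K + 1) * π) /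
          Lg ^ 6 := by
        gcongr
    _ = C82 K / Lg ^ 6 := by rw [C82]; ring

/-- **Lemma 8.2 (general shifts).** For `χ` primitive mod `D`, `𝓛 = log D ≥ 3`,
the MINIMUM PREMISE `‖L(1,χ)‖ ≤ 𝓛^{-15}` in place of (A), `K ≥ 0` with `8Kπ ≤ 𝓛⁸` ("`D` large in terms of `K`"), purely
imaginary shifts `β, β′` with `‖β‖, ‖β′‖ ≤ Kα` (`α = π𝓛^{-9}`, (2.10)), and
`T = exp(𝓛^{1.1}) ≤ x ≤ P = exp(𝓛⁹)`:
`‖∑_{m ≤ x} χ(m) m^{β−1} (x/m)^{β′} log(x/m) − L′(1,χ) 𝔣(x)‖ ≤ C82(2K) 𝓛^{-6}`,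
`𝔣(x) = (1 + (β′ − β) log x) x^{β′}` (`frakf β β′ (log x)` of `Section8MainTerms`).
[cite: Zhang2022LandauSiegel, §8, Lemma 8.2] -/
theorem lemma82_general_of_norm_le_pow15 {D : ℕ} [NeZero D] (χ : DirichletCharacter ℂ D)
    (hprim : χ.IsPrimitive) (hL : 3 ≤ Real.log D) (h15 : ‖χ.LFunction 1‖ ≤ 1 / Real.log D ^ 15)
    {K : ℝ} (hK0 : 0 ≤ K) (hK : 8 * K * π ≤ Real.log D ^ 8) {β β' : ℂ} (hβre : β.re = 0)
    (hβ're : β'.re = 0) (hβ : ‖β‖ ≤ K * π / Real.log D ^ 9) (hβ' : ‖β'‖ ≤ K * π / Real.log D ^ 9)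
    {x : ℝ} (hxT : Real.exp (Real.log D ^ (11 / 10 : ℝ)) ≤ x) (hxP : x ≤ Real.exp (Real.log D ^ 9)) :
    ‖(∑ m ∈ Finset.Ioc 0 ⌊x⌋₊, χ (m : ZMod D) * (m : ℂ) ^ (β - 1) * (((x / m : ℝ)) : ℂ) ^ β' *
        (Real.log (x / m) : ℂ)) - deriv χ.LFunction 1 * frakf β β' (Real.log x)‖ ≤
      C82 (2 * K) / Real.log D ^ 6 := by
  have hx0 : 0 < x := lt_of_lt_of_le (Real.exp_pos _) hxT
  set δ : ℂ := β' - β with hδdef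
  have hδre : δ.re = 0 := by simp [hδdef, hβre, hβ're]
  have hδ : ‖δ‖ ≤ 2 * K * π / Real.log D ^ 9 := by
    calc ‖δ‖ ≤ ‖β'‖ + ‖β‖ := norm_sub_le _ _
      _ ≤ K * π / Real.log D ^ 9 + K * π / Real.log D ^ 9 := add_le_add hβ' hβ
      _ = 2 * K * π / Real.log D ^ 9 := by ring
  have hcore := sum_twist_log_sub_main_le_pow15 χ hprim hL h15 (K := 2 * K) (by positivity)
    (by linarith) hδre hδ hxT hxP
  -- rewrite the printed sum and main term through `x^{β′}`
  have hsum : (∑ m ∈ Finset.Ioc 0 ⌊x⌋₊, χ (m : ZMod D) * (m : ℂ) ^ (β - 1) *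
      (((x / m : ℝ)) : ℂ) ^ β' * (Real.log (x / m) : ℂ)) =
      cexp (β' * (Real.log x : ℂ)) *
        ∑ m ∈ Finset.Ioc 0 ⌊x⌋₊, twist χ δ m * (Real.log (x / m) : ℂ) := by
    rw [Finset.mul_sum]
    refine Finset.sum_congr rfl fun m hm => ?_
    have hm0 : m ≠ 0 := Nat.pos_iff_ne_zero.1 (Finset.mem_Ioc.1 hm).1
    rw [hδdef]
    exact summand_eq χ β β' hx0 hm0
  have hmain : frakf β β' (Real.log x) =
      cexp (β' * (Real.log x : ℂ)) * (1 + δ * (Real.log x : ℂ)) := by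
    rw [frakf, hδdef]; ring
  rw [hsum, hmain, ← mul_assoc, mul_comm (deriv χ.LFunction 1) (cexp _), mul_assoc, ← mul_sub,
    norm_mul, norm_cexp_imag_mul_log hβ're, one_mul]
  exact hcore

/-- **Zhang (2022), Lemma 8.2, as printed.** Fix the constant `c′ ≥ 0` of (2.13). There is
`C = C(c′)` such that for every primitive `χ` mod `D` with `𝓛 = log D ≥ 3` and
`8(3 + 5c′)π ≤ 𝓛⁸` (i.e. `D ≥ D₀(c′)`), under the MINIMUM PREMISE `‖L(1,χ)‖ ≤ 𝓛^{-15}` in place of (A), for every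
`β_j ∈ {β₁, β₂, β₃}` ((2.13)), `β_μ ∈ {β₆, β₇} = {3iα/2, 5iα/2}` ((2.22)) and `T ≤ x ≤ P`
(`T = exp 𝓛^{1.1}`, `P = exp 𝓛⁹`):
`∑_{m<x} χ(m) m^{-(1−β_j)} (x/m)^{β_μ} log(x/m) = L′(1,χ) 𝔣_{jμ}(x) + O(𝓛^{-6})`,
`𝔣_{jμ}(x) = (1 + (β_μ − β_j) log x) x^{β_μ}` — precisely, the norm of the difference is
`≤ C 𝓛^{-6}`. (The sum over `m ≤ x` equals the printed `∑_{m<x}`: the term `m = x` carries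
`log(x/m) = 0`.) [cite: Zhang2022LandauSiegel, §8, Lemma 8.2] -/
theorem lemma82_of_norm_le_pow15 {c' : ℝ} (hc' : 0 ≤ c') : ∃ C : ℝ, ∀ (D : ℕ) [NeZero D]
    (χ : DirichletCharacter ℂ D), χ.IsPrimitive → 3 ≤ Real.log D →
    ‖χ.LFunction 1‖ ≤ 1 / Real.log D ^ 15 → 8 * (3 + 5 * c') * π ≤ Real.log D ^ 8 →
    ∀ βj ∈ ({beta1 c' (Real.log D), beta2 c' (Real.log D), beta3 c' (Real.log D)} : Set ℂ),
    ∀ βμ ∈ ({betaMain (3 / 2) (π / Real.log D ^ 9), betaMain (5 / 2) (π / Real.log D ^ 9)} : Set ℂ),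
    ∀ x : ℝ, Real.exp (Real.log D ^ (11 / 10 : ℝ)) ≤ x → x ≤ Real.exp (Real.log D ^ 9) →
    ‖(∑ m ∈ Finset.Ioc 0 ⌊x⌋₊, χ (m : ZMod D) * (m : ℂ) ^ (βj - 1) * (((x / m : ℝ)) : ℂ) ^ βμ *
        (Real.log (x / m) : ℂ)) - deriv χ.LFunction 1 * frakf βj βμ (Real.log x)‖ ≤
      C / Real.log D ^ 6 := by
  refine ⟨C82 (2 * (3 + 5 * c')), fun D _ χ hprim hL h15 hD βj hβj βμ hβμ x hxT hxP => ?_⟩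
  have hall := shifts_bound hc' hL
  have hj := hall βj (by
    simp only [Set.mem_insert_iff, Set.mem_singleton_iff] at hβj ⊢; tauto)
  have hμ := hall βμ (by
    simp only [Set.mem_insert_iff, Set.mem_singleton_iff] at hβμ ⊢; tauto)
  exact lemma82_general_of_norm_le_pow15 χ hprim hL h15 (K := 3 + 5 * c') (by positivity) (by linarith)
    hj.1 hμ.1 hj.2 hμ.2 hxT hxP

/-- **Lemma 8.2 as consumed in §8** [the display after Lemma 8.4]: "By Lemma 8.2 with `x = P₁/dr` …
`∑_m χ(m)ϰ₁(drm)/m^{1−β_j} = (L′(1,χ)/log P₁)·𝔣_{j6}(P₁/dr) + O(𝓛⁻¹⁵)` if `dr < P₁/T`"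
(`log P₁ ≍ 𝓛⁹`, so `O(𝓛⁻⁶/log P₁) = O(𝓛⁻¹⁵)`). Here for any level `P₁ ≤ P = e^{𝓛⁹}`, any
`k = dr ≥ 1` with `kT ≤ P₁`, and purely imaginary shifts `‖β_j‖, ‖β_μ‖ ≤ Kα` (`8Kπ ≤ 𝓛⁸`):
`‖∑_{m} χ(m)ϰ(km)m^{β_j−1} − (L′(1,χ)/log P₁)·𝔣(P₁/k)‖ ≤ C82(2K)/(𝓛⁶ log P₁)`.
[cite: Zhang2022LandauSiegel, §8, Lemma 8.2 and the display after Lemma 8.4] -/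
theorem lemma82_varkappa_of_norm_le_pow15 {D : ℕ} [NeZero D] (χ : DirichletCharacter ℂ D)
    (hprim : χ.IsPrimitive) (hL : 3 ≤ Real.log D) (h15 : ‖χ.LFunction 1‖ ≤ 1 / Real.log D ^ 15)
    {K : ℝ} (hK0 : 0 ≤ K) (hK : 8 * K * π ≤ Real.log D ^ 8) {βj βμ : ℂ} (hβjre : βj.re = 0)
    (hβμre : βμ.re = 0) (hβj : ‖βj‖ ≤ K * π / Real.log D ^ 9) (hβμ : ‖βμ‖ ≤ K * π / Real.log D ^ 9)
    {P₁ : ℝ} (hP₁P : P₁ ≤ Real.exp (Real.log D ^ 9)) {k : ℕ} (hk : 1 ≤ k)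
    (hkT : Real.exp (Real.log D ^ (11 / 10 : ℝ)) * k ≤ P₁) :
    ‖(∑ m ∈ Finset.Ioc 0 ⌊P₁ / k⌋₊, χ (m : ZMod D) * varkappa P₁ βμ (k * m) * (m : ℂ) ^ (βj - 1)) -
        deriv χ.LFunction 1 / (Real.log P₁ : ℂ) * frakf βj βμ (Real.log (P₁ / k))‖ ≤
      C82 (2 * K) / (Real.log D ^ 6 * Real.log P₁) := by
  have hk0 : (0 : ℝ) < k := by exact_mod_cast hk
  have hT1 : 1 < Real.exp (Real.log D ^ (11 / 10 : ℝ)) := by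
    have : (0 : ℝ) < Real.log D ^ (11 / 10 : ℝ) := Real.rpow_pos_of_pos (by linarith) _
    exact Real.one_lt_exp_iff.2 this
  have hT0 : 0 < Real.exp (Real.log D ^ (11 / 10 : ℝ)) := Real.exp_pos _
  set x : ℝ := P₁ / k with hxdef
  have hxT : Real.exp (Real.log D ^ (11 / 10 : ℝ)) ≤ x := by
    rw [hxdef, le_div_iff₀ hk0]; exact hkT
  have hx1 : 1 < x := lt_of_lt_of_le hT1 hxT
  have hP₁1 : 1 < P₁ := by
    have h1 : (1 : ℝ) ≤ k := by exact_mod_cast hk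
    have hP0 : 0 ≤ P₁ := le_trans (by positivity) hkT
    have : x ≤ P₁ := by rw [hxdef]; exact div_le_self hP0 h1
    linarith
  have hlogP : 0 < Real.log P₁ := Real.log_pos hP₁1
  have hxP : x ≤ Real.exp (Real.log D ^ 9) := by
    refine le_trans ?_ hP₁P
    rw [hxdef]; exact div_le_self (by linarith) (by exact_mod_cast hk)
  have hgen := lemma82_general_of_norm_le_pow15 χ hprim hL h15 hK0 hK hβjre hβμre hβj hβμ hxT hxP
  -- the sum is `(1/log P₁)` times the sum of Lemma 8.2 at `x = P₁/k`
  have hsum : (∑ m ∈ Finset.Ioc 0 ⌊P₁ / k⌋₊, χ (m : ZMod D) * varkappa P₁ βμ (k * m) *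
      (m : ℂ) ^ (βj - 1)) = (1 / (Real.log P₁ : ℂ)) *
      ∑ m ∈ Finset.Ioc 0 ⌊x⌋₊, χ (m : ZMod D) * (m : ℂ) ^ (βj - 1) * (((x / m : ℝ)) : ℂ) ^ βμ *
        (Real.log (x / m) : ℂ) := by
    rw [← hxdef, Finset.mul_sum]
    refine Finset.sum_congr rfl fun m hm => ?_
    have hm1 : 1 ≤ m := (Finset.mem_Ioc.1 hm).1
    have hmx : (m : ℝ) ≤ x := by
      have := (Finset.mem_Ioc.1 hm).2
      exact le_trans (by exact_mod_cast this) (Nat.floor_le (by linarith))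
    rw [varkappa_mul_eq hP₁1 βμ hk hm1 (by rwa [hxdef] at hmx), ← hxdef]
    push_cast
    field_simp
  have hlogC : (Real.log P₁ : ℂ) ≠ 0 := by exact_mod_cast hlogP.ne'
  rw [hsum, show (1 / (Real.log P₁ : ℂ)) * (∑ m ∈ Finset.Ioc 0 ⌊x⌋₊, χ (m : ZMod D) *
      (m : ℂ) ^ (βj - 1) * (((x / m : ℝ)) : ℂ) ^ βμ * (Real.log (x / m) : ℂ)) -
      deriv χ.LFunction 1 / (Real.log P₁ : ℂ) * frakf βj βμ (Real.log x) =
      (1 / (Real.log P₁ : ℂ)) * ((∑ m ∈ Finset.Ioc 0 ⌊x⌋₊, χ (m : ZMod D) *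
      (m : ℂ) ^ (βj - 1) * (((x / m : ℝ)) : ℂ) ^ βμ * (Real.log (x / m) : ℂ)) -
      deriv χ.LFunction 1 * frakf βj βμ (Real.log x)) by field_simp, norm_mul]
  have hn : ‖(1 / (Real.log P₁ : ℂ))‖ = 1 / Real.log P₁ := by
    rw [norm_div, norm_one, Complex.norm_real, Real.norm_eq_abs, abs_of_pos hlogP]
  rw [hn, div_mul_eq_div_div, le_div_iff₀ hlogP]
  calc 1 / Real.log P₁ * ‖(∑ m ∈ Finset.Ioc 0 ⌊x⌋₊, χ (m : ZMod D) * (m : ℂ) ^ (βj - 1) *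
        (((x / m : ℝ)) : ℂ) ^ βμ * (Real.log (x / m) : ℂ)) - deriv χ.LFunction 1 * frakf βj βμ
          (Real.log x)‖ * Real.log P₁
      = ‖(∑ m ∈ Finset.Ioc 0 ⌊x⌋₊, χ (m : ZMod D) * (m : ℂ) ^ (βj - 1) *
        (((x / m : ℝ)) : ℂ) ^ βμ * (Real.log (x / m) : ℂ)) - deriv χ.LFunction 1 * frakf βj βμ
          (Real.log x)‖ := by field_simp
    _ ≤ C82 (2 * K) / Real.log D ^ 6 := hgen

/-- **The printed instance**: `∑_m χ(m)ϰ_i(drm)m^{β_j−1} = (L′(1,χ)/log P_i)𝔣_{jμ}(P_i/dr) + O(𝓛⁻⁶/log P_i)`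
for `β_j ∈ {β₁,β₂,β₃}(c′)`, `β_μ ∈ {β₆,β₇}`, any level `P_i ≤ P` and `dr·T ≤ P_i` (with
`log P₁ = 0.504𝓛⁹`, `log P₂ = 0.5𝓛⁹ − 10𝓛^{1.1}` this is the printed `O(𝓛⁻¹⁵)`).
[cite: Zhang2022LandauSiegel, §8, the display after Lemma 8.4] -/
theorem lemma82_varkappa_printed_of_norm_le_pow15 {c' : ℝ} (hc' : 0 ≤ c') : ∃ C : ℝ, ∀ (D : ℕ) [NeZero D]
    (χ : DirichletCharacter ℂ D), χ.IsPrimitive → 3 ≤ Real.log D →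
    ‖χ.LFunction 1‖ ≤ 1 / Real.log D ^ 15 → 8 * (3 + 5 * c') * π ≤ Real.log D ^ 8 →
    ∀ βj ∈ ({beta1 c' (Real.log D), beta2 c' (Real.log D), beta3 c' (Real.log D)} : Set ℂ),
    ∀ βμ ∈ ({betaMain (3 / 2) (π / Real.log D ^ 9), betaMain (5 / 2) (π / Real.log D ^ 9)} : Set ℂ),
    ∀ P₁ : ℝ, P₁ ≤ Real.exp (Real.log D ^ 9) → ∀ k : ℕ, 1 ≤ k →
    Real.exp (Real.log D ^ (11 / 10 : ℝ)) * k ≤ P₁ →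
    ‖(∑ m ∈ Finset.Ioc 0 ⌊P₁ / k⌋₊, χ (m : ZMod D) * varkappa P₁ βμ (k * m) * (m : ℂ) ^ (βj - 1)) -
        deriv χ.LFunction 1 / (Real.log P₁ : ℂ) * frakf βj βμ (Real.log (P₁ / k))‖ ≤
      C / (Real.log D ^ 6 * Real.log P₁) := by
  refine ⟨C82 (2 * (3 + 5 * c')), fun D _ χ hprim hL h15 hD βj hβj βμ hβμ P₁ hP k hk hkT => ?_⟩
  have hall := shifts_bound hc' hL
  have hj := hall βj (by
    simp only [Set.mem_insert_iff, Set.mem_singleton_iff] at hβj ⊢; tauto)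
  have hμ := hall βμ (by
    simp only [Set.mem_insert_iff, Set.mem_singleton_iff] at hβμ ⊢; tauto)
  exact lemma82_varkappa_of_norm_le_pow15 χ hprim hL h15 (K := 3 + 5 * c') (by positivity) (by linarith)
    hj.1 hμ.1 hj.2 hμ.2 hP hk hkT

end Literature.NumberTheory.LFunctions.Zhang2022.Repair.Gap
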